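import Literature.NumberTheory.EllipticCurves.TakahashiRankOneOfEichlerSelberg
import Literature.NumberTheory.EllipticCurves.EichlerBasisTheoremOfTraceIdentity
import Literature.NumberTheory.EllipticCurves.TakahashiDegreeFormulaCoprimeProofs
import Literature.NumberTheory.EllipticCurves.SzpiroFreyConductorProofs
import HarnessLib

/-!
# Stub ideas k3 — GENERATION 2 (FAMILY 3, probe the extremes) for `stub_takahashi`
# (`takahashi2001_thm_2_3_of_coprime`), crux `DefiniteRTControlPrime`, route `DefiniteXi`

Scratch sketch (ideator's folder; elaboration sanity of the helper-lemma signatures).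
Gen-1 (tree file `Cruxes/DefiniteRTControlPrime/StubIdeas3Sketch.lean`) split the stub into
H1 (rank one) + H2 (character-group dictionary) and reduced H1 to H0 = Pizer's trace identity at
coprime level as a NEW named fact.  Gen-2 removes that new fact: H0 follows from the tree's EXISTING
named fact `HeckeTraceFormulaGL2Level N 1 2` (all `N`) plus ONE new local lemma `L3` (optimal
embedding numbers of Eichler orders of prime-power level `q^e` versus the Cohen–Oesterlé local
density at `q^e`, chain-summed), everything else being square-free-hypothesis deletions (`L1`,
`L2` proved here, `L4`–`L6` ports).  `T3` = the Frey-scope reshape (only `q = 2`, `e ≤ 8` is new).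
-/

noncomputable section

open scoped BigOperators Matrix
open scoped ArithmeticFunction.sigma
open ArithmeticFunction Finset

set_option linter.dupNamespace false

namespace Summit.ABC.ABC.Cruxes.DefiniteRTControlPrime.StubIdeas3g2

open Literature.NumberTheory.EllipticCurves Literature.NumberTheory.EllipticCurves.ModularForms
open Literature.NumberTheory.Automorphic Literature.NumberTheory.Automorphic.Brandt
open Literature.NumberTheory.Automorphic.HeckeTraceFormulaGL2Level
open Literature.NumberTheory.EllipticCurves.BrandtJL
open NumberField IsDedekindDomain

/-! ### L1 — the CO local density is a product over the prime-power factors (S; from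
`localDensity_one_mul` by induction on `M.primeFactors`) -/
def LocalDensityPrimePow : Prop :=
  ∀ (M : ℕ) [NeZero M] (t : ℤ) (f n : ℕ), (f : ℤ) ^ 2 ∣ t ^ 2 - 4 * n →
    localDensity M 1 t f n = ∏ q ∈ M.primeFactors, localDensity (q ^ M.factorization q) 1 t f n

/-! ### L2 — the level-`q^e` matrix model of `O_(q)` (S; PROVED: `exists_levelModel` used
`Squarefree M` only to rewrite `M.factorization q = 1`) -/
def ExistsLevelPowModel : Prop :=
  ∀ {M p : ℕ} (S : XiSetup M p), M ≠ 0 → ∀ {q : ℕ} [Fact q.Prime], q ∣ M → ¬ q ∣ p →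
    ∃ Φ : S.D →ₐ[ℚ] Matrix (Fin 2) (Fin 2) ℚ_[q],
      ∀ y : S.D, y ∈ localAt q S.O ↔
        (∀ i j, ‖Φ y i j‖ ≤ 1) ∧ ‖Φ y 1 0‖ ≤ (q : ℝ) ^ (-(M.factorization q : ℤ))

theorem existsLevelPowModel_holds : ExistsLevelPowModel := by
  intro M p S hM q hq _hqM hqp
  have hD : ∀ x : S.D, x ≠ 0 → IsUnit x :=
    fun _ hx => isUnit_of_isTotallyDefinite S.D S.isTotallyDefinite hx
  have hram : ∀ v : HeightOneSpectrum (𝓞 ℚ),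
      v ∈ ramifiedPlaces ℚ S.D ↔ ((p : ℕ) : 𝓞 ℚ) ∈ v.asIdeal :=
    S.toEichlerPackage.mem_ramifiedPlaces_iff
  obtain ⟨φ⟩ := exists_algHom_matrix_of_not_dvd (B := S.D) hram hqp
  obtain ⟨u, hu⟩ := S.toEichlerPackage.isEichlerOrder.exists_conjUnit_localAt_iff_eichler hD hM φ
  exact ⟨AlgHom.conjUnit φ u, hu⟩

/-! ### L3 — THE new lemma: local embedding numbers at prime-power level, chain-summed against the
CO density (L/XL; Hijikata 1974 §2 local factors `c_q(s,f)` + Pizer 1980 proof of Thm 2.25;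
`e = 1` is the tree's `LevelHyp.localEmbeddingNumber_eq` + `sum_hw_es_eq_sum_hw_br`).
`A` = the product of the local factors at the other primes (constant on `q`-chains `f ↦ fq`). -/
def LocalChainIdentityPow : Prop :=
  ∀ {M p : ℕ} (S : XiSetup M p), M ≠ 0 → p.Prime → ¬ p ∣ M →
    ∀ {γ : S.D} {t : ℤ} {n : ℕ}, GammaHyp γ t n → n.Coprime M →
    ∀ {q : ℕ}, q.Prime → q ∣ M →
    ∀ A : ℕ → ℚ, (∀ f ∈ ellipticConductors t n, f * q ∈ ellipticConductors t n → A (f * q) = A f) →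
      (((∑ f ∈ ellipticConductors t n,
          hw t n f * A f * (localEmbeddingNumber S.O γ (ordOf γ t n f) q : ℚ)) : ℚ) : ℂ) =
        ∑ f ∈ ellipticConductors t n,
          ((hw t n f * A f : ℚ) : ℂ) * localDensity (q ^ M.factorization q) 1 t f n

/-- L3b — the other local embedding numbers are constant on `q`-chains (S/M; `localAt q'` of
`B_{fq}` equals `localAt q'` of `B_f` for `q' ≠ q`). -/
def LocalEmbeddingNumberChainConst : Prop :=
  ∀ {M p : ℕ} (S : XiSetup M p) {γ : S.D} {t : ℤ} {n : ℕ}, GammaHyp γ t n →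
    ∀ {q q' : ℕ}, q.Prime → q'.Prime → q ≠ q' →
    ∀ f ∈ ellipticConductors t n, f * q ∈ ellipticConductors t n →
      localEmbeddingNumber S.O γ (ordOf γ t n (f * q)) q' = localEmbeddingNumber S.O γ (ordOf γ t n f) q'

/-! ### L4 — the `t`-th elliptic term at coprime level (M; = `XiSetup.ellipticTerm_eq` with
`Squarefree M` deleted; proof: `sum_card_traceNormSet_div_eq_finsum` + `card_throughClass` with the
local factors left symbolic, then L1 + L3 prime by prime (L3b for chain-constancy) + the tree's
ramified swap `swap_ram`). -/
def EllipticTermEqCoprime : Prop :=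
  ∀ {M p : ℕ} (S : XiSetup M p) [Fintype (ClassSet S.O)] [NeZero M],
    p.Prime → ¬ p ∣ M → ∀ {n : ℕ}, n.Coprime (M * p) → ∀ {t : ℤ}, t ^ 2 < 4 * n →
    ((∑ i, (Nat.card (traceNormSet i.rep (t : ℚ) (n : ℚ)) : ℚ) / (2 * weight S.O i) : ℚ) : ℂ) =
      (1 / 2 : ℂ) * ∑ f ∈ ellipticConductors t n,
        (weightedClassNumber ((t ^ 2 - 4 * n) / (f : ℤ) ^ 2) : ℂ) *
          (localDensity M 1 t f n * (2 - localDensity p 1 t f n))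

/-! ### L5 — Eichler's trace formula with symbolic mass term at coprime level (S; verbatim port of
`XiSetup.trace_matrix_eq_sumInvWeight_add`, whose only use of `hsq` is `S.ellipticTerm_eq hsq`) -/
def TraceMatrixEqSumInvWeightAddCoprime : Prop :=
  ∀ {M p : ℕ} (S : XiSetup M p) [Fintype (ClassSet S.O)] [NeZero M],
    p.Prime → ¬ p ∣ M → ∀ n : ℕ, 0 < n → n.Coprime (M * p) →
    (((Brandt.matrix S.O n).trace : ℤ) : ℂ) =
      (if IsSquare n then ∑ i, (1 : ℂ) / (weight S.O i : ℂ) else 0) +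
        (1 / 2 : ℂ) *
          ∑ t ∈ (Finset.Icc (-(2 * n : ℤ)) (2 * n)).filter (fun t : ℤ => t ^ 2 < 4 * (n : ℤ)),
            ∑ f ∈ ellipticConductors t n,
              (weightedClassNumber ((t ^ 2 - 4 * n) / (f : ℤ) ^ 2) : ℂ) *
                (localDensity M 1 t f n * (2 - localDensity p 1 t f n))

theorem traceMatrixEqSumInvWeightAddCoprime_of (h4 : EllipticTermEqCoprime) :
    TraceMatrixEqSumInvWeightAddCoprime := by
  intro M p S _ _ hp hpM n hn0 hn
  have hQ := S.trace_matrix_eq_mass_add_sum hn0.ne'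
  have hQC := congrArg (fun x : ℚ => (x : ℂ)) hQ
  beta_reduce at hQC
  push_cast at hQC
  rw [hQC, Finset.mul_sum]
  congr 1
  · split_ifs <;> push_cast <;> ring
  · refine Finset.sum_congr rfl fun t ht => ?_
    rw [Finset.mem_filter] at ht
    have := h4 S hp hpM hn ht.2
    push_cast at this
    exact this

/-! ### L6 — mass formula AND Pizer's trace identity at coprime level from the two `GL₂`
Eichler–Selberg identities at levels `Mp`, `M` (S; verbatim port of
`sumInvWeight_eq_and_traceIdentity_of_cuspidalHeckeTrace_eq` — its `geometricSide_one_two_mul_prime_sub`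
has no square-free hypothesis — with L5 for `trace_matrix_eq_sumInvWeight_add hsq`). -/
def SumInvWeightEqAndTraceIdentityCoprime : Prop :=
  ∀ {M p : ℕ} [NeZero M] [NeZero (M * p)], p.Prime → ¬ p ∣ M →
    ∀ (S : XiSetup M p) [Fintype (ClassSet S.O)],
    (∀ n : ℕ, 0 < n → n.Coprime (M * p) → cuspidalHeckeTrace (M * p) 2 1 n = geometricSide (M * p) 1 2 n) →
    (∀ n : ℕ, 0 < n → n.Coprime (M * p) → cuspidalHeckeTrace M 2 1 n = geometricSide M 1 2 n) →
    (∑ i, (1 : ℂ) / (weight S.O i : ℂ)) = ((p : ℂ) - 1) * (dedekindPsi M : ℂ) / 12 ∧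
      ∀ n : ℕ, 0 < n → n.Coprime (M * p) →
        cuspidalHeckeTrace (M * p) 2 1 n =
          (((Brandt.matrix S.O n).trace : ℤ) : ℂ) - ((σ 1 n : ℕ) : ℂ) + 2 * cuspidalHeckeTrace M 2 1 n

/-! ### H0 (gen-1 `pizerTraceIdentity_of_coprime`, restated) and H1 (rank one at `r ∥ N`) -/
def PizerTraceIdentityCoprime : Prop :=
  ∀ (M r : ℕ) [NeZero M] [NeZero (M * r)], r.Prime → M.Coprime r →
    ∀ (S : Brandt.XiSetup M r) [Fintype (Brandt.ClassSet S.O)], ∀ n : ℕ, 0 < n → n.Coprime (M * r) →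
      cuspidalHeckeTrace (M * r) 2 1 n =
        (((Brandt.matrix S.O n).trace : ℤ) : ℂ) - ((σ 1 n : ℕ) : ℂ) + 2 * cuspidalHeckeTrace M 2 1 n

def BrandtEigenLatticeRankOneCoprime : Prop :=
  ∀ (W : WeierstrassCurve ℚ) [W.IsElliptic] (M r : ℕ) [NeZero (M * r)],
    r.Prime → M.Coprime r → W.conductorNorm ℤ = M * r →
    ∀ (_P : ModularParametrizationData W (M * r)) (S : Brandt.XiSetup M r)
      [Fintype (Brandt.ClassSet S.O)],
      Module.finrank ℤ
        (Brandt.eigenLattice (M * r) (Brandt.matrix S.O) (fun n => W.LFunction n)) = 1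

/-- **Assembly of Plan A′ (PROVED glue): L6 + the tree's named fact `HeckeTraceFormulaGL2Level`
(in its weakest form, the identities for `(n, N) = 1`) ⇒ H0.**  No square-free hypothesis anywhere. -/
theorem pizerTraceIdentityCoprime_of (h6 : SumInvWeightEqAndTraceIdentityCoprime)
    (hES : ∀ (N : ℕ) [NeZero N], ∀ n : ℕ, 0 < n → n.Coprime N →
      cuspidalHeckeTrace N 2 1 n = geometricSide N 1 2 n) :
    PizerTraceIdentityCoprime := by
  intro M r _ _ hr hcop S _ n hn0 hn
  have hrM : ¬ r ∣ M := fun h => hr.one_lt.ne' ((Nat.coprime_comm.mp hcop).eq_one_of_dvd h |>.symm ▸ rfl)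
  exact (h6 hr hrM S (fun n hn0 hn => hES (M * r) n hn0 hn)
    (fun n hn0 hn => hES M n hn0 (Nat.Coprime.coprime_dvd_right (dvd_mul_right M r) hn))).2 n hn0 hn

/-- **H0 ⇒ H1 (PROVED glue, = gen-1 `rank_one_of_coprime_of_traceIdentity`).** -/
theorem rankOneCoprime_of (h0 : PizerTraceIdentityCoprime) : BrandtEigenLatticeRankOneCoprime := by
  intro W _ M r _ hr hcop _hN P S _
  haveI : NeZero M := ⟨fun h0 => NeZero.ne (M * r) (by rw [h0, zero_mul])⟩
  exact finrank_eigenLattice_eq_one_of_traceIdentity S (h0 M r hr hcop S) W hr.one_lt P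

/-! ### T3 — Frey-scope reshape: the crux instantiates the stub only at `M = N(Frey)/q` with
`N ∣ 2⁸ rad(ab(a+b))`, i.e. `M = 2^e m`, `m` odd square-free, `e ≤ 8`.  Scoped stub + the shape
lemma; with it, L3 is needed only for `q = 2`, `2 ≤ e ≤ 8` (the odd `q ∣ m` are the tree's `e = 1`). -/
def takahashi2001_thm_2_3_of_coprime_dyadic : Prop :=
  ∀ (W : WeierstrassCurve ℚ) [W.IsElliptic] (M r : ℕ) [NeZero (M * r)], r.Prime → M.Coprime r →
    Squarefree (M / 2 ^ M.factorization 2) → M.factorization 2 ≤ 8 →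
    W.conductorNorm ℤ = M * r →
    ∀ P : ModularParametrizationData W (M * r),
      (∀ (W' : WeierstrassCurve ℚ) [W'.IsElliptic], W'.conductorNorm ℤ = M * r →
          ∀ P' : ModularParametrizationData W' (M * r), P'.f = P.f → P.modularDegree ≤ P'.modularDegree) →
      ∀ S : Brandt.XiSetup M r, ∃ i j : ℕ, 0 < i ∧ i * j = (W.minimalDiscriminantNorm ℤ).factorization r ∧
        i ∣ S.xi (fun n => W.LFunction n) ∧ P.modularDegree * i = S.xi (fun n => W.LFunction n) * j

theorem dyadic_of_stub (h : takahashi2001_thm_2_3_of_coprime) : takahashi2001_thm_2_3_of_coprime_dyadic :=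
  fun W _ M r _ hr hcop _ _ hN P hmin S => h W M r hr hcop hN P hmin S

/-- T3b — the Frey cofactor has the dyadic shape (S; from `conductorNorm_freyCurve_dvd_holds`:
`N ∣ 2⁸ · rad(ab(a+b))`, exactly as `stub_freyLocal` was proved). -/
def FreyCofactorDyadicShape : Prop :=
  ∀ (a b : ℤ), IsCoprime a b → a * b * (a + b) ≠ 0 → ∀ q : ℕ, q.Prime → q ≠ 2 →
    q ∣ (freyCurve a b).conductorNorm ℤ →
      Squarefree (((freyCurve a b).conductorNorm ℤ / q) / 2 ^ ((freyCurve a b).conductorNorm ℤ / q).factorization 2) ∧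
        ((freyCurve a b).conductorNorm ℤ / q).factorization 2 ≤ 8


end Summit.ABC.ABC.Cruxes.DefiniteRTControlPrime.StubIdeas3g2

end
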